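import Literature.NumberTheory.Transcendental.SemialgebraicMapsProofs
import Literature.NumberTheory.Transcendental.SemialgebraicLineDeriv
import HarnessLib

/-!
# `LogPrimitiveNL` (stmt-KontsevichZagierPeriods-2836), line `ax-schanuel-germs`, stub `stub_structure` —
part A: restriction of semialgebraic data to a real line

Helpers for the lead's structure theorem: base change of semialgebraicity from `ℚ` to `ℝ`
coefficients, the `ℝ`-semialgebraicity of the one-variable restriction `t ↦ F (x₀ + t • v)` of a
semialgebraic function along a real line (real base point and direction), its smoothness and its
derivative along the line, and arithmetic closure of `ℝ`-semialgebraic functions. Folklore real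
semialgebraic geometry (Bochnak–Coste–Roy 1998, §2.1–2.2) on top of the tree's
`IsSemialgebraic.preimage_aeval`, `IsSemialgebraicFunOn.add_holds`/`mul_holds`.
-/

noncomputable section

open Set Filter MvPolynomial
open scoped ContDiff Topology
open Literature.NumberTheory.Transcendental Literature.ModelTheory.ExponentialFields

namespace Summit.KontsevichZagierPeriods.LiouvilleUnfolding.LogPrimitiveNL.AxSchanuelGerms

/-! ### Base change `ℚ → ℝ` of the coefficient ring -/

/-- Evaluating a rational polynomial after mapping its coefficients to `ℝ`. [folklore] -/
theorem aeval_map_algebraMap_rat {ι : Type*} (x : ι → ℝ) (p : MvPolynomial ι ℚ) :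
    aeval x (MvPolynomial.map (algebraMap ℚ ℝ) p) = aeval x p := by
  rw [MvPolynomial.aeval_def, MvPolynomial.eval₂_map, MvPolynomial.aeval_def]
  congr 1

/-- A `ℚ`-semialgebraic set is `ℝ`-semialgebraic (map the coefficients of the defining
polynomials along `ℚ → ℝ`). [folklore] -/
theorem isSemialgebraic_real_of_rat {ι : Type*} {s : Set (ι → ℝ)} (hs : IsSemialgebraic ℚ s) :
    IsSemialgebraic ℝ s := by
  induction hs using BooleanSubalgebra.closure_bot_sup_induction with
  | mem t ht =>
    rcases ht with ⟨p, rfl⟩ | ⟨p, rfl⟩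
    · convert isSemialgebraic_setOf_eval_eq_zero (R := ℝ) (MvPolynomial.map (algebraMap ℚ ℝ) p)
        using 1
      ext x
      simp only [mem_setOf_eq, aeval_map_algebraMap_rat]
    · convert isSemialgebraic_setOf_eval_pos (R := ℝ) (MvPolynomial.map (algebraMap ℚ ℝ) p)
        using 1
      ext x
      simp only [mem_setOf_eq, aeval_map_algebraMap_rat]
  | bot => exact isSemialgebraic_empty
  | sup t _ u _ iht ihu => exact iht.union ihu
  | compl t _ iht => exact iht.compl

/-- A `ℚ`-semialgebraic function is `ℝ`-semialgebraic. [folklore] -/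
theorem isSemialgebraicFunOn_real_of_rat {m : ℕ} {s : Set (Fin m → ℝ)} {f : (Fin m → ℝ) → ℝ}
    (hf : IsSemialgebraicFunOn ℚ s f) : IsSemialgebraicFunOn ℝ s f :=
  isSemialgebraic_real_of_rat hf

/-! ### Arithmetic of `ℝ`-semialgebraic functions -/

/-- Real constants are `ℝ`-semialgebraic functions. [folklore] -/
theorem isSemialgebraicFunOn_real_const {m : ℕ} {s : Set (Fin m → ℝ)} (hs : IsSemialgebraic ℝ s)
    (c : ℝ) : IsSemialgebraicFunOn ℝ s (fun _ => c) :=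
  (isSemialgebraicFunOn_aeval hs (MvPolynomial.C c)).congr fun x _ => by simp

/-- Coordinates are `ℝ`-semialgebraic functions. [folklore] -/
theorem isSemialgebraicFunOn_real_apply {m : ℕ} {s : Set (Fin m → ℝ)} (hs : IsSemialgebraic ℝ s)
    (i : Fin m) : IsSemialgebraicFunOn ℝ s (fun x => x i) :=
  (isSemialgebraicFunOn_aeval hs (MvPolynomial.X i)).congr fun x _ => by simp

/-- Sums of `ℝ`-semialgebraic functions. [folklore] -/
theorem isSemialgebraicFunOn_real_add {m : ℕ} {s : Set (Fin m → ℝ)} {f g : (Fin m → ℝ) → ℝ}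
    (hf : IsSemialgebraicFunOn ℝ s f) (hg : IsSemialgebraicFunOn ℝ s g) :
    IsSemialgebraicFunOn ℝ s (fun x => f x + g x) :=
  IsSemialgebraicFunOn.add_holds hf hg

/-- Products of `ℝ`-semialgebraic functions. [folklore] -/
theorem isSemialgebraicFunOn_real_mul {m : ℕ} {s : Set (Fin m → ℝ)} {f g : (Fin m → ℝ) → ℝ}
    (hf : IsSemialgebraicFunOn ℝ s f) (hg : IsSemialgebraicFunOn ℝ s g) :
    IsSemialgebraicFunOn ℝ s (fun x => f x * g x) :=
  IsSemialgebraicFunOn.mul_holds hf hg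

/-- Finite sums of `ℝ`-semialgebraic functions. [folklore] -/
theorem isSemialgebraicFunOn_real_finsetSum {m : ℕ} {s : Set (Fin m → ℝ)} (hs : IsSemialgebraic ℝ s)
    {ι : Type*} (t : Finset ι) {f : ι → (Fin m → ℝ) → ℝ}
    (hf : ∀ i ∈ t, IsSemialgebraicFunOn ℝ s (f i)) :
    IsSemialgebraicFunOn ℝ s (fun x => ∑ i ∈ t, f i x) := by
  classical
  induction t using Finset.induction_on with
  | empty => simpa using isSemialgebraicFunOn_real_const hs 0
  | insert a t ha ih =>
    have h := isSemialgebraicFunOn_real_add (hf a (Finset.mem_insert_self a t))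
      (ih fun i hi => hf i (Finset.mem_insert_of_mem hi))
    refine h.congr fun x _ => ?_
    simp [Finset.sum_insert ha]

/-- Real linear combinations of `ℝ`-semialgebraic functions. [folklore] -/
theorem isSemialgebraicFunOn_real_linearCombination {m : ℕ} {s : Set (Fin m → ℝ)}
    (hs : IsSemialgebraic ℝ s) {ι : Type*} [Fintype ι] (c : ι → ℝ) {f : ι → (Fin m → ℝ) → ℝ}
    (hf : ∀ i, IsSemialgebraicFunOn ℝ s (f i)) :
    IsSemialgebraicFunOn ℝ s (fun x => ∑ i, c i * f i x) :=
  isSemialgebraicFunOn_real_finsetSum hs Finset.univ fun i _ =>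
    isSemialgebraicFunOn_real_mul (isSemialgebraicFunOn_real_const hs (c i)) (hf i)

/-! ### Restriction to a real line -/

/-- The open interval, as a subset of `ℝ¹`, is `ℝ`-semialgebraic. [folklore] -/
theorem isSemialgebraic_setOf_apply_mem_Ioo (a b : ℝ) :
    IsSemialgebraic ℝ {x : Fin 1 → ℝ | x 0 ∈ Ioo a b} := by
  have h1 : IsSemialgebraic ℝ {x : Fin 1 → ℝ | 0 < aeval x (X 0 - C a : MvPolynomial (Fin 1) ℝ)} :=
    isSemialgebraic_setOf_eval_pos _
  have h2 : IsSemialgebraic ℝ {x : Fin 1 → ℝ | 0 < aeval x (C b - X 0 : MvPolynomial (Fin 1) ℝ)} :=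
    isSemialgebraic_setOf_eval_pos _
  convert h1.inter h2 using 1
  ext x
  simp [mem_Ioo, sub_pos]

/-- **Restriction of a semialgebraic function to a real line is semialgebraic over `ℝ`.** If `F` is
`ℝ`-semialgebraic on `U ⊆ ℝⁿ` and the segment `{x₀ + t v | t ∈ (a, b)}` lies in `U`, then
`t ↦ F (x₀ + t v)` is `ℝ`-semialgebraic on `(a, b) ⊆ ℝ¹` (its graph is the preimage of the graph of
`F` under the polynomial map `(t, y) ↦ (x₀ + t v, y)`). [folklore] -/
theorem isSemialgebraicFunOn_comp_line {n : ℕ} {U : Set (Fin n → ℝ)} {F : (Fin n → ℝ) → ℝ}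
    (hF : IsSemialgebraicFunOn ℝ U F) (x₀ v : Fin n → ℝ) {a b : ℝ}
    (hseg : ∀ t ∈ Ioo a b, x₀ + t • v ∈ U) :
    IsSemialgebraicFunOn ℝ {x : Fin 1 → ℝ | x 0 ∈ Ioo a b} (fun x => F (x₀ + x 0 • v)) := by
  -- the polynomial map `Φ : ℝ² → ℝⁿ⁺¹`, `(t, y) ↦ (x₀ + t v, y)`
  let P : Fin (n + 1) → MvPolynomial (Fin 2) ℝ :=
    Fin.snoc (fun j => C (x₀ j) + X 0 * C (v j)) (X 1)
  have hP : ∀ w : Fin 2 → ℝ, (fun j => aeval w (P j)) =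
      Fin.snoc (x₀ + w 0 • v) (w 1) := by
    intro w
    ext j
    refine Fin.lastCases ?_ (fun i => ?_) j
    · simp [P]
    · simp [P, Pi.add_apply, Pi.smul_apply, smul_eq_mul, mul_comm]
  have hpre := (show IsSemialgebraic ℝ _ from hF).preimage_aeval P
  have hI : IsSemialgebraic ℝ {w : Fin 2 → ℝ | w 0 ∈ Ioo a b} := by
    simpa using (isSemialgebraic_setOf_apply_mem_Ioo a b).preimage_comp (fun _ : Fin 1 => (0 : Fin 2))
  have heq : {z : Fin (1 + 1) → ℝ | ∃ x ∈ {x : Fin 1 → ℝ | x 0 ∈ Ioo a b},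
      z = Fin.snoc x (F (x₀ + x 0 • v))} =
      {w : Fin 2 → ℝ | w 0 ∈ Ioo a b} ∩
        (fun w j => aeval w (P j)) ⁻¹' {z : Fin (n + 1) → ℝ | ∃ x ∈ U, z = Fin.snoc x (F x)} := by
    ext w
    simp only [mem_setOf_eq, mem_inter_iff, mem_preimage, hP w]
    constructor
    · rintro ⟨x, hx, rfl⟩
      refine ⟨by simpa using hx, x₀ + x 0 • v, hseg _ hx, ?_⟩
      have h1 : (Fin.snoc x (F (x₀ + x 0 • v)) : Fin 2 → ℝ) 1 = F (x₀ + x 0 • v) :=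
        Fin.snoc_last (α := fun _ => ℝ) (x := F (x₀ + x 0 • v)) (p := x)
      have h0 : (Fin.snoc x (F (x₀ + x 0 • v)) : Fin 2 → ℝ) 0 = x 0 :=
        Fin.snoc_castSucc (α := fun _ => ℝ) (x := F (x₀ + x 0 • v)) (p := x) (i := 0)
      rw [h0, h1]
    · rintro ⟨hw, x, hxU, hx⟩
      refine ⟨Fin.init w, by simpa [Fin.init] using hw, ?_⟩
      have h0 : x₀ + w 0 • v = x := by
        have := congr_arg Fin.init hx
        simpa using this
      have h1 : w 1 = F x := by
        have := congr_fun hx (Fin.last n)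
        simpa using this
      ext j
      refine Fin.lastCases ?_ (fun i => ?_) j
      · simp only [Fin.snoc_last]
        rw [show (Fin.init w : Fin 1 → ℝ) 0 = w 0 from rfl, h0, ← h1]
        rfl
      · simp only [Fin.snoc_castSucc]
        rw [Subsingleton.elim i 0]
        rfl
  show IsSemialgebraic ℝ _
  rw [heq]
  exact hI.inter hpre

/-! ### Smoothness and derivative of the restriction to a line -/

/-- The affine parametrisation `t ↦ x₀ + t v` of a line is smooth. [folklore] -/
theorem contDiff_lineMap {n : ℕ} (x₀ v : Fin n → ℝ) : ContDiff ℝ ∞ (fun t : ℝ => x₀ + t • v) :=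
  contDiff_const.add (contDiff_id.smul contDiff_const)

/-- The affine parametrisation `t ↦ x₀ + t v` has derivative `v`. [folklore] -/
theorem hasDerivAt_lineMap {n : ℕ} (x₀ v : Fin n → ℝ) (t : ℝ) :
    HasDerivAt (fun s : ℝ => x₀ + s • v) v t := by
  simpa using ((hasDerivAt_id t).smul_const v).const_add x₀

/-- A function `C^∞` on an open set containing the segment restricts to a `C^∞` function of the
line parameter. [folklore] -/
theorem contDiffOn_comp_line {n : ℕ} {C : Set (Fin n → ℝ)} {F : (Fin n → ℝ) → ℝ}
    (hF : ContDiffOn ℝ ∞ F C) (x₀ v : Fin n → ℝ) {a b : ℝ}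
    (hseg : ∀ t ∈ Ioo a b, x₀ + t • v ∈ C) :
    ContDiffOn ℝ ∞ (fun t : ℝ => F (x₀ + t • v)) (Ioo a b) :=
  hF.comp (contDiff_lineMap x₀ v).contDiffOn fun t ht => hseg t ht

/-- A continuous linear functional on `ℝⁿ` evaluated at `v` is the `v`-combination of its values on
the coordinate vectors. [folklore] -/
theorem clm_apply_eq_sum_single {n : ℕ} (L : (Fin n → ℝ) →L[ℝ] ℝ) (v : Fin n → ℝ) :
    L v = ∑ j, v j * L (Pi.single j 1) := by
  have hv : v = ∑ j, v j • (Pi.single j (1 : ℝ) : Fin n → ℝ) := by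
    conv_lhs => rw [(Finset.univ_sum_single v).symm]
    refine Finset.sum_congr rfl fun j _ => ?_
    rw [← Pi.single_smul, smul_eq_mul, mul_one]
  conv_lhs => rw [hv]
  rw [map_sum]
  refine Finset.sum_congr rfl fun j _ => ?_
  rw [map_smul, smul_eq_mul]

/-- **Derivative along the line.** At a parameter `t` with `x₀ + t v` in the open set `C` on which
`F` is `C^∞`, the restriction `s ↦ F (x₀ + s v)` has derivative `Σⱼ vⱼ ∂ⱼF (x₀ + t v)`. [folklore] -/
theorem hasDerivAt_comp_line {n : ℕ} {C : Set (Fin n → ℝ)} (hC : IsOpen C) {F : (Fin n → ℝ) → ℝ}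
    (hF : ContDiffOn ℝ ∞ F C) (x₀ v : Fin n → ℝ) {t : ℝ} (ht : x₀ + t • v ∈ C) :
    HasDerivAt (fun s : ℝ => F (x₀ + s • v))
      (∑ j, v j * fderiv ℝ F (x₀ + t • v) (Pi.single j 1)) t := by
  have hd : DifferentiableAt ℝ F (x₀ + t • v) :=
    (hF.differentiableOn (by simp)).differentiableAt (hC.mem_nhds ht)
  have h := hd.hasFDerivAt.comp_hasDerivAt t (hasDerivAt_lineMap x₀ v t)
  rwa [clm_apply_eq_sum_single] at h

/-- The derivative of the restriction to a line, as an equation. [folklore] -/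
theorem deriv_comp_line {n : ℕ} {C : Set (Fin n → ℝ)} (hC : IsOpen C) {F : (Fin n → ℝ) → ℝ}
    (hF : ContDiffOn ℝ ∞ F C) (x₀ v : Fin n → ℝ) {t : ℝ} (ht : x₀ + t • v ∈ C) :
    deriv (fun s : ℝ => F (x₀ + s • v)) t = ∑ j, v j * fderiv ℝ F (x₀ + t • v) (Pi.single j 1) :=
  (hasDerivAt_comp_line hC hF x₀ v ht).deriv

/-- **The derivative of the restriction is `ℝ`-semialgebraic.** For `F` `ℚ`-semialgebraic and `C^∞`
on an open `ℚ`-semialgebraic `C` containing the segment `{x₀ + t v | t ∈ (a, b)}`, the derivative of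
`t ↦ F (x₀ + t v)` is an `ℝ`-semialgebraic function on `(a, b)` (partials are `ℚ`-semialgebraic,
Basu–Pollack–Roy Prop. 3.22 via `IsSemialgebraicFunOn.fderiv_apply_single`; base change; real
linear combination; restriction to the line). [folklore] -/
theorem isSemialgebraicFunOn_deriv_comp_line {n : ℕ} {C : Set (Fin n → ℝ)} (hCs : IsSemialgebraic ℚ C)
    (hC : IsOpen C) {F : (Fin n → ℝ) → ℝ} (hFs : IsSemialgebraicFunOn ℚ C F)
    (hF : ContDiffOn ℝ ∞ F C) (x₀ v : Fin n → ℝ) {a b : ℝ}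
    (hseg : ∀ t ∈ Ioo a b, x₀ + t • v ∈ C) :
    IsSemialgebraicFunOn ℝ {x : Fin 1 → ℝ | x 0 ∈ Ioo a b}
      (fun x => deriv (fun s : ℝ => F (x₀ + s • v)) (x 0)) := by
  have hd : ∀ x ∈ C, DifferentiableAt ℝ F x := fun x hx =>
    (hF.differentiableOn (by simp)).differentiableAt (hC.mem_nhds hx)
  have hpart : ∀ j : Fin n, IsSemialgebraicFunOn ℝ C fun x => fderiv ℝ F x (Pi.single j 1) :=
    fun j => isSemialgebraicFunOn_real_of_rat (IsSemialgebraicFunOn.fderiv_apply_single hC hFs hd j)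
  have hG : IsSemialgebraicFunOn ℝ C fun x => ∑ j, v j * fderiv ℝ F x (Pi.single j 1) :=
    isSemialgebraicFunOn_real_linearCombination (isSemialgebraic_real_of_rat hCs) v hpart
  refine (isSemialgebraicFunOn_comp_line hG x₀ v hseg).congr fun x hx => ?_
  exact (deriv_comp_line hC hF x₀ v (hseg _ hx)).symm

/-- **Registered ∀-form** of `isSemialgebraicFunOn_deriv_comp_line` (helper of `stub_structure`,
line `ax-schanuel-germs`): the derivative of the restriction of a smooth `ℚ`-semialgebraic function
to a real line is `ℝ`-semialgebraic on the parameter interval. [folklore] -/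
theorem structure_lineRestrict_deriv : ∀ (n : ℕ) (C : Set (Fin n → ℝ)) (F : (Fin n → ℝ) → ℝ)
    (x₀ v : Fin n → ℝ) (a b : ℝ), IsSemialgebraic ℚ C → IsOpen C → IsSemialgebraicFunOn ℚ C F →
    ContDiffOn ℝ ∞ F C → (∀ t ∈ Ioo a b, x₀ + t • v ∈ C) →
    IsSemialgebraicFunOn ℝ {x : Fin 1 → ℝ | x 0 ∈ Ioo a b}
      (fun x => deriv (fun s : ℝ => F (x₀ + s • v)) (x 0)) :=
  fun _ _ _ x₀ v _ _ hCs hC hFs hF hseg => isSemialgebraicFunOn_deriv_comp_line hCs hC hFs hF x₀ v hseg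

end Summit.KontsevichZagierPeriods.LiouvilleUnfolding.LogPrimitiveNL.AxSchanuelGerms

end
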